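import Summits.PneNP.PneNP.Theses.MatroidTseitin
import Literature.Computability.MetaComplexity.GaussianWidth

/-!
# PneNP / MatroidTseitin — `ExpandingXorDepthFregeLB` follows from `GaussianWidthDepthFregeLB`
(stmt-PneNP-11426 ⇐ stmt-PneNP-11425, helper file)

Route `PneNP/MatroidTseitin`, crux item stmt-PneNP-11426
(`Summit.PneNP.PneNP.Theses.MatroidTseitin.ExpandingXorDepthFregeLB`, Ben-Sasson–Wigderson for
bounded-depth Frege: unsolvable `ℓ`-sparse systems over `𝔽₂` whose row supports form a
`(δn, c)`-boundary expander need depth-`d` Frege refutations of size `≥ 2^(n^ε)`). The route's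
two-layer plan derives it from the Gaussian-width law
(`Summit.PneNP.PneNP.Theses.MatroidTseitin.GaussianWidthDepthFregeLB`, item stmt-PneNP-11425)
through the glue "`(δn, c)`-expansion gives Gaussian width `≥ cδn/2`", which is the Literature
theorem `Literature.Computability.MetaComplexity.le_gaussianWidth_of_isBoundaryExpander` read
through `le_gaussianWidth_iff` (the inlined hypothesis of the width law). This file does the
remaining real-number bookkeeping and records the implication.

* `rpow_half_le_rpow_of_sqrt_le` — `x ^ (ε/2) ≤ w ^ ε` once `√x ≤ w`.
* `expandingXorDepthFregeLB_of_gaussianWidthDepthFregeLB` — the implication, with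
  `ε := ε₁ / 2`, `w := ⌊cδn/2⌋₊` and `N := ⌈1/δ + 2N₁/(cδ) + 16/(cδ)² + 1⌉₊`.

References: E. Ben-Sasson, A. Wigderson, *Short proofs are narrow — resolution made simple*,
J. ACM 48 (2001), §5–6 [BenSassonWigderson2001]; E. Ben-Sasson, R. Impagliazzo, *Random CNF's are
hard for the polynomial calculus*, Comput. Complexity 19 (2010) [BenSassonImpagliazzo2010].
-/

namespace Summit.PneNP.PneNP.Theorems

set_option linter.dupNamespace false -- `Summit.PneNP.PneNP.…`: summit = sub-problem (D-0017)

open Finset Literature.Computability.MetaComplexity Literature.Computability.Complexity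

/-- Real bookkeeping for the exponents: if `√x ≤ w` (`x, ε ≥ 0`) then `x ^ (ε / 2) ≤ w ^ ε`.
[folklore] -/
theorem rpow_half_le_rpow_of_sqrt_le {x w ε : ℝ} (hx : 0 ≤ x) (hε : 0 ≤ ε)
    (h : Real.sqrt x ≤ w) : x ^ (ε / 2) ≤ w ^ ε := by
  calc x ^ (ε / 2) = (x ^ (1 / 2 : ℝ)) ^ ε := by
        rw [← Real.rpow_mul hx]; ring_nf
    _ = Real.sqrt x ^ ε := by rw [Real.sqrt_eq_rpow]
    _ ≤ w ^ ε := Real.rpow_le_rpow (Real.sqrt_nonneg x) h hε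

open Summit.PneNP.PneNP.Theses.MatroidTseitin in
/-- **`GaussianWidthDepthFregeLB → ExpandingXorDepthFregeLB`** (item stmt-PneNP-11426 follows
from item stmt-PneNP-11425; the `[deps: GaussianWidthDepthFregeLB]` edge of route
`PneNP/MatroidTseitin`). Given the width law with constants `ε₁, N₁` for `(ℓ, d)` and expansion
parameters `δ, c > 0`: for `n ≥ N := ⌈1/δ + 2N₁/(cδ) + 16/(cδ)² + 1⌉₊` a `(δn, c)`-boundary
expander has Gaussian width `≥ w := ⌊cδn/2⌋₊ ≥ N₁`
(`le_gaussianWidth_of_isBoundaryExpander`, `le_gaussianWidth_iff`), so its depth-`d` refutations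
have size `≥ 2^(w^ε₁) ≥ 2^(n^(ε₁/2))` (as `w ≥ cδn/2 - 1 ≥ √n`). The unsolvability hypothesis is
not needed. [cite: BenSassonWigderson2001, §5–6] -/
theorem expandingXorDepthFregeLB_of_gaussianWidthDepthFregeLB (h : GaussianWidthDepthFregeLB) :
    ExpandingXorDepthFregeLB := by
  intro ℓ d δ c hδ hc
  obtain ⟨ε, hε, N₁, hN⟩ := h ℓ d
  set K : ℝ := c * δ with hK
  have hK0 : 0 < K := mul_pos hc hδ
  refine ⟨ε / 2, half_pos hε, ⌈1 / δ + 2 * N₁ / K + 16 / K ^ 2 + 1⌉₊,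
    fun n hn m E hsparse hexp _hunsat π hπ => ?_⟩
  have hn' : 1 / δ + 2 * N₁ / K + 16 / K ^ 2 + 1 ≤ (n : ℝ) := Nat.ceil_le.1 hn
  have hN1 : (0 : ℝ) ≤ N₁ := Nat.cast_nonneg N₁
  have h1 : 0 ≤ 1 / δ := by positivity
  have h2 : 0 ≤ 2 * (N₁ : ℝ) / K := by positivity
  have h3 : 0 ≤ 16 / K ^ 2 := by positivity
  have hn0 : (0 : ℝ) ≤ n := Nat.cast_nonneg n
  have hn1 : (1 : ℝ) ≤ n := by linarith
  -- `r = δ n ≥ 1`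
  have hr1 : (1 : ℝ) ≤ δ * n := by
    have h := mul_le_mul_of_nonneg_left (show 1 / δ ≤ (n : ℝ) by linarith) hδ.le
    rwa [mul_one_div_cancel hδ.ne'] at h
  -- the width parameter `w = ⌊K n / 2⌋₊`
  have hKn : 0 ≤ K * n / 2 := by positivity
  set w : ℕ := ⌊K * n / 2⌋₊ with hw
  have hw_le : (w : ℝ) ≤ c * (δ * n) / 2 := by
    calc (w : ℝ) ≤ K * n / 2 := Nat.floor_le hKn
      _ = c * (δ * n) / 2 := by rw [hK]; ring
  have hw_ge : K * n / 2 - 1 ≤ (w : ℝ) := by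
    have := Nat.lt_floor_add_one (K * n / 2)
    linarith
  have hN1w : N₁ ≤ w := by
    apply Nat.le_floor
    have h := mul_le_mul_of_nonneg_left (show 2 * (N₁ : ℝ) / K ≤ n by linarith) hK0.le
    rw [mul_div_assoc', mul_comm K, mul_div_assoc, div_self hK0.ne', mul_one] at h
    linarith
  -- Gaussian width `≥ w` from expansion (Literature)
  have hgw := (le_gaussianWidth_iff E w).1
    (le_gaussianWidth_of_isBoundaryExpander E hc hr1 hexp hw_le)
  have key : (2 : ℝ) ^ ((w : ℝ) ^ ε) ≤ (proofSize π : ℝ) := hN m n w E hsparse hN1w hgw π hπ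
  -- `√n ≤ w`
  have hsqrt4 : 4 / K ≤ Real.sqrt n := by
    apply Real.le_sqrt_of_sq_le
    rw [div_pow]
    norm_num
    linarith
  have hsqrt1 : 1 ≤ Real.sqrt n := by
    rw [show (1 : ℝ) = Real.sqrt 1 from Real.sqrt_one.symm]
    exact Real.sqrt_le_sqrt hn1
  have hsqrt : Real.sqrt n ≤ (w : ℝ) := by
    have hmul : (4 : ℝ) * Real.sqrt n ≤ K * n := by
      have h := mul_le_mul_of_nonneg_left hsqrt4 (mul_nonneg hK0.le (Real.sqrt_nonneg n))
      calc (4 : ℝ) * Real.sqrt n = K * Real.sqrt n * (4 / K) := by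
            field_simp
        _ ≤ K * Real.sqrt n * Real.sqrt n := h
        _ = K * n := by rw [mul_assoc, Real.mul_self_sqrt hn0]
    linarith
  calc (2 : ℝ) ^ ((n : ℝ) ^ (ε / 2)) ≤ (2 : ℝ) ^ ((w : ℝ) ^ ε) :=
        Real.rpow_le_rpow_of_exponent_le (by norm_num)
          (rpow_half_le_rpow_of_sqrt_le hn0 hε.le hsqrt)
    _ ≤ (proofSize π : ℝ) := key

end Summit.PneNP.PneNP.Theorems
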